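import Literature.Probability.LatticeModels.LatticeSineGordon
import Summits.QuantumFields.YangMills.Theorems.SmallCircleAnchorAnchorGapStubDebyeScreening2

/-!
# Crux `AnchorGap` (stmt-QuantumFields-11141), line `registered` — exact folding over the dual lattice (soft layer under stub DSred)

Stub DSred (`stub_debyeScreening`) concerns the `ε`-regulated `k`-component lattice sine-Gordon
measure `dμ_ε ∝ weight α g ε ζ dφ` on the torus (`Literature.Probability.LatticeModels.LatticeSineGordon`)
and observables that are periodic under the lattice `Λ*` dual to the charges.  For the commensurate
basis `b` (`α_r · b_j ∈ 2πℤ`, `Λ' = Σ_j ℤ b_j ⊆ Λ*`) the constant shifts `φ ↦ φ + Σ_j n_j b_j`,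
`n ∈ ℤᵏ`, act measure-preservingly on configurations, and `{φ | θ̄(φ) ∈ D_b}` — zero mode
`θ̄(φ) = V⁻¹ Σ_x φ(x,·)` in the fundamental cell `D_b = {Σ_j t_j b_j | t ∈ [0,1)ᵏ}` — is a fundamental
domain (`ZSpan.exist_unique_vadd_mem_fundamentalDomain`).  Since the tilt and a periodic observable are
invariant and the regulator transforms by the explicit factor of `weight_add_dual`, unfolding
(`IsAddFundamentalDomain.integral_eq_tsum''`) and resumming inside the integral (`integral_tsum`) give
the EXACT identities

* `integral_mul_weight_fold` : `∫ H weight = ∫_{θ̄ ∈ D_b} H · weight · Θ̃`,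
  `Θ̃(φ) = Σ_{n ∈ ℤᵏ} exp(−(2g²)⁻¹ ε Σ_p (2 φ_p w_n + w_n²))`, `w_n = Σ_j n_j b_j`;
* `integral_mul_weight_fold_flat` : the same with `weight · Θ̃ = W · Θ_a(θ̄)`, where
  `W = weight · e^{(2g²)⁻¹ ε V⁻¹ Σ_a (Σ_x φ(x,a))²} = exp(−(2g²)⁻¹[‖∇φ‖² + ε‖φ − θ̄‖²] + tilt)` is the
  FLAT reference weight (compact zero mode with flat prior on `D_b`, mass `ε` on non-constant modes
  only) and `Θ_a(θ̄) = Σ_n e^{−(a/2)|θ̄ + w_n|²}`, `a = εV/g²`, is the lattice theta sum of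
  `…StubDebyeScreening6/7.lean`, flat on `D_b` as `a → 0` (`latticeTheta_flat`).

Together with `latticeTheta_flat` this is the fixed-volume `ε → 0` step of DSred without any `ε = 0`
object: regulated expectations of periodic observables equal flat-reference expectations up to a
factor-`(1 + o(1))` reweighting of the zero mode.
-/

set_option autoImplicit false

noncomputable section

namespace Summit.QuantumFields.YangMills.Theorems.AnchorGap

open MeasureTheory Finset
open Literature.Probability.LatticeModels

/-- **Exact folding of the regulated measure over the dual lattice.** Let `b` be a basis of `ℝᵏ`
of vectors dual to the charges (`α_r · b_j ∈ 2πℤ`), `g ≠ 0`, `ε > 0`, and `H` a bounded measurable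
observable invariant under the constant field shifts `φ ↦ φ + Σ_j n_j b_j`, `n ∈ ℤᵏ`.  Then
`∫ H · weight = ∫_{θ̄(φ) ∈ D_b} H · weight · Θ̃`, where `θ̄(φ) = V⁻¹ Σ_x φ(x, ·)` is the zero mode
(`V = #sites`), `D_b = {Σ_j t_j b_j | t ∈ [0,1)ᵏ}` the fundamental cell of `Λ' = Σ_j ℤ b_j`, and
`Θ̃(φ) = Σ_{n ∈ ℤᵏ} exp(−(2g²)⁻¹ ε Σ_p (2 φ_p w_n + w_n²))`, `w_n = Σ_j n_j b_j`, is the sum over the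
sectors of the regulator factors of `weight_add_dual`: the set `{θ̄ ∈ D_b}` is a fundamental domain for
the measure-preserving action of `ℤᵏ` on configurations (`ZSpan.exist_unique_vadd_mem_fundamentalDomain`),
so `∫ f = Σ_n ∫_{θ̄ ∈ D_b} f(φ + w_n)` (`IsAddFundamentalDomain.integral_eq_tsum''`), and the sum is
taken back inside the integral (`integral_tsum`). [folklore] -/
theorem integral_mul_weight_fold :
    ∀ (d N k : ℕ) [NeZero N] (ι : Type) [Fintype ι] (α : ι → Fin k → ℝ) (b : Fin k → Fin k → ℝ), LinearIndependent ℝ b → (∀ (j : Fin k) (r : ι), ∃ z : ℤ, ∑ a : Fin k, α r a * b j a = 2 * Real.pi * z) → ∀ (g ε ζ : ℝ), g ≠ 0 → 0 < ε → ∀ (H : LatticeSineGordon.Config d N k → ℝ), Measurable H → ∀ (C₀ : ℝ), (∀ φ, |H φ| ≤ C₀) → (∀ (φ : LatticeSineGordon.Config d N k) (n : Fin k → ℤ), H (fun p => φ p + ∑ j : Fin k, (n j : ℝ) * b j p.2) = H φ) → ∫ φ : LatticeSineGordon.Config d N k, H φ * LatticeSineGordon.weight α g ε ζ φ = ∫ φ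 : LatticeSineGordon.Config d N k, {φ : LatticeSineGordon.Config d N k | ∃ t : Fin k → ℝ, (∀ j : Fin k, 0 ≤ t j ∧ t j < 1) ∧ ∀ a : Fin k, (Fintype.card (TorusSite d N) : ℝ)⁻¹ * ∑ x : TorusSite d N, φ (x, a) = ∑ j : Fin k, t j * b j a}.indicator (fun φ => H φ * LatticeSineGordon.weight α g ε ζ φ * ∑' n : Fin k → ℤ, Real.exp (-((2 * g ^ 2)⁻¹ * (ε * ∑ p : TorusSite d N × Fin k, (2 * φ p * (∑ j : Fin k, (n j : ℝ) * b j p.2) + (∑ j : Fin k, (n j : ℝ) * b j p.2) ^ 2))))) φ := by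
  intro d N k _ ι _ α b hb hcomm g ε ζ hg hε H hHm C₀ hHC hHper
  classical
  -- notation: volume `V`, lattice vectors `w n`, zero mode `θb`
  set V : ℝ := (Fintype.card (TorusSite d N) : ℝ) with hV
  have hVpos : 0 < V := by
    rw [hV]; exact_mod_cast Fintype.card_pos
  have hVne : V ≠ 0 := hVpos.ne'
  set w : (Fin k → ℤ) → Fin k → ℝ := fun n c => ∑ j, (n j : ℝ) * b j c with hw
  set θb : LatticeSineGordon.Config d N k → Fin k → ℝ := fun φ c => V⁻¹ * ∑ x, φ (x, c) with hθb
  set S : Set (LatticeSineGordon.Config d N k) := {φ | ∃ t : Fin k → ℝ, (∀ j : Fin k, 0 ≤ t j ∧ t j < 1) ∧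
    ∀ a : Fin k, V⁻¹ * ∑ x : TorusSite d N, φ (x, a) = ∑ j : Fin k, t j * b j a} with hS
  -- the basis and its fundamental cell
  let B := basisOfPiSpaceOfLinearIndependent hb
  have hB : ⇑B = b := coe_basisOfPiSpaceOfLinearIndependent hb
  let L : Submodule ℤ (Fin k → ℝ) := Submodule.span ℤ (Set.range B)
  let e : (Fin k → ℤ) ≃ L := (B.restrictScalars ℤ).equivFun.symm.toEquiv
  have he : ∀ n : Fin k → ℤ, ((e n : L) : Fin k → ℝ) = w n := by
    intro n
    simp only [e, LinearEquiv.coe_toEquiv, Module.Basis.equivFun_symm_apply, hw]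
    rw [Submodule.coe_sum]
    funext c
    simp [Module.Basis.restrictScalars_apply, ← hB, zsmul_eq_mul, Finset.sum_apply]
  have hD : ∀ θ : Fin k → ℝ, (∃ t : Fin k → ℝ, (∀ j : Fin k, 0 ≤ t j ∧ t j < 1) ∧
      ∀ a : Fin k, θ a = ∑ j : Fin k, t j * b j a) ↔ θ ∈ ZSpan.fundamentalDomain B := by
    intro θ
    rw [ZSpan.mem_fundamentalDomain]
    constructor
    · rintro ⟨t, ht, hθt⟩ i
      have hθ : θ = ∑ j, t j • B j := by
        funext a
        rw [hθt a, Finset.sum_apply]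
        simp [hB, smul_eq_mul]
      rw [hθ, Module.Basis.repr_sum_self]
      exact ⟨(ht i).1, (ht i).2⟩
    · intro h
      refine ⟨fun j => B.repr θ j, fun j => ⟨(h j).1, (h j).2⟩, fun a => ?_⟩
      conv_lhs => rw [← B.sum_repr θ]
      rw [Finset.sum_apply]
      simp [hB, smul_eq_mul]
  have hSpre : S = θb ⁻¹' ZSpan.fundamentalDomain B := by
    ext φ
    simp only [hS, Set.mem_setOf_eq, Set.mem_preimage]
    exact hD (θb φ)
  have hθb_cont : Continuous θb := by
    rw [hθb]; fun_prop
  have hSmeas : MeasurableSet S := by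
    rw [hSpre]
    exact measurableSet_preimage hθb_cont.measurable (ZSpan.fundamentalDomain_measurableSet B)
  -- the action of `ℤᵏ` on configurations by constant dual-lattice shifts
  letI act : AddAction (Fin k → ℤ) (LatticeSineGordon.Config d N k) :=
    { vadd := fun n φ => fun p => φ p + w n p.2
      zero_vadd := fun φ => by
        funext p
        show φ p + w 0 p.2 = φ p
        simp [hw]
      add_vadd := fun m n φ => by
        funext p
        show φ p + w (m + n) p.2 = (φ p + w n p.2) + w m p.2
        simp only [hw, Pi.add_apply, Int.cast_add, add_mul, sum_add_distrib]
        ring }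
  have hvadd : ∀ (n : Fin k → ℤ) (φ : LatticeSineGordon.Config d N k),
      n +ᵥ φ = fun p => φ p + w n p.2 := fun _ _ => rfl
  have hvadd' : ∀ (n : Fin k → ℤ), (fun φ : LatticeSineGordon.Config d N k => n +ᵥ φ) =
      fun φ => φ + fun p => w n p.2 := fun n => rfl
  haveI : MeasurableConstVAdd (Fin k → ℤ) (LatticeSineGordon.Config d N k) :=
    ⟨fun n => by rw [hvadd']; exact measurable_add_const _⟩
  haveI hri : (volume : Measure (LatticeSineGordon.Config d N k)).IsAddRightInvariant := by
    rw [volume_pi]; exact Measure.pi.isAddRightInvariant _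
  haveI : VAddInvariantMeasure (Fin k → ℤ) (LatticeSineGordon.Config d N k) volume :=
    ⟨fun n s _ => by rw [hvadd']; exact measure_preimage_add_right _ _ _⟩
  -- zero mode of a shifted configuration
  have hθvadd : ∀ (n : Fin k → ℤ) (φ : LatticeSineGordon.Config d N k), θb (n +ᵥ φ) = θb φ + w n := by
    intro n φ
    funext c
    simp only [hθb, hvadd, Pi.add_apply, sum_add_distrib, sum_const, card_univ, nsmul_eq_mul]
    rw [← hV]
    field_simp
  -- `S` is a fundamental domain
  have hfd : IsAddFundamentalDomain (Fin k → ℤ) S volume := by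
    refine IsAddFundamentalDomain.mk' hSmeas.nullMeasurableSet fun φ => ?_
    have hex := ZSpan.exist_unique_vadd_mem_fundamentalDomain B (θb φ)
    rw [hSpre]
    refine (e.existsUnique_congr fun n => ?_).2 hex
    rw [Set.mem_preimage, hθvadd, Submodule.vadd_def, vadd_eq_add, he, add_comm]
  -- integrability of `H · weight`
  have hint : Integrable (fun φ : LatticeSineGordon.Config d N k => H φ * LatticeSineGordon.weight α g ε ζ φ) :=
    LatticeSineGordon.integrable_mul_weight α hg hε ζ hHm.aestronglyMeasurable hHC
  -- the lattice vectors are dual to the charges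
  have hwdual : ∀ (n : Fin k → ℤ) (r : ι), ∃ z : ℤ, ∑ a, α r a * w n a = 2 * Real.pi * z := by
    intro n r
    choose z hz using fun j => hcomm j r
    refine ⟨∑ j, n j * z j, ?_⟩
    calc ∑ a, α r a * w n a = ∑ j, (n j : ℝ) * ∑ a, α r a * b j a := by
          simp only [hw, mul_sum]
          rw [sum_comm]
          exact sum_congr rfl fun j _ => sum_congr rfl fun a _ => by ring
      _ = ∑ j, (n j : ℝ) * (2 * Real.pi * z j) := sum_congr rfl fun j _ => by rw [hz j]
      _ = 2 * Real.pi * ((∑ j, n j * z j : ℤ) : ℝ) := by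
          push_cast
          rw [mul_sum]
          exact sum_congr rfl fun j _ => by ring
  -- each folded term
  set ef : (Fin k → ℤ) → LatticeSineGordon.Config d N k → ℝ := fun n φ =>
    Real.exp (-((2 * g ^ 2)⁻¹ * (ε * ∑ p : TorusSite d N × Fin k, (2 * φ p * w n p.2 + w n p.2 ^ 2)))) with hef
  have hterm : ∀ (n : Fin k → ℤ) (φ : LatticeSineGordon.Config d N k),
      H (n +ᵥ φ) * LatticeSineGordon.weight α g ε ζ (n +ᵥ φ) =
        H φ * LatticeSineGordon.weight α g ε ζ φ * ef n φ := by
    intro n φ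
    rw [hvadd, hHper φ n, weight_add_dual d N k ι α g ε ζ (w n) (hwdual n) φ, hef, mul_assoc]
  -- measurability of the folded terms
  have hef_cont : ∀ n : Fin k → ℤ, Continuous (ef n) := by
    intro n; rw [hef]; fun_prop
  have hF_meas : ∀ n : Fin k → ℤ, AEStronglyMeasurable
      (fun φ : LatticeSineGordon.Config d N k => H φ * LatticeSineGordon.weight α g ε ζ φ * ef n φ)
      (volume.restrict S) := by
    intro n
    exact ((hHm.mul (LatticeSineGordon.continuous_weight α g ε ζ).measurable).mul
      (hef_cont n).measurable).aestronglyMeasurable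
  -- summability of the folded absolute integrals: they refold to `∫ |H| weight < ∞`
  have hF_sum : ∑' n : Fin k → ℤ, ∫⁻ φ in S, ‖H φ * LatticeSineGordon.weight α g ε ζ φ * ef n φ‖ₑ ≠ ⊤ := by
    have hre : ∀ (n : Fin k → ℤ) (φ : LatticeSineGordon.Config d N k),
        ‖H φ * LatticeSineGordon.weight α g ε ζ φ * ef n φ‖ₑ =
          ‖H (n +ᵥ φ) * LatticeSineGordon.weight α g ε ζ (n +ᵥ φ)‖ₑ := by
      intro n φ; rw [hterm]
    simp_rw [hre]
    rw [← hfd.lintegral_eq_tsum'' (fun φ => ‖H φ * LatticeSineGordon.weight α g ε ζ φ‖ₑ)]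
    exact hint.hasFiniteIntegral.ne
  -- fold
  rw [hfd.integral_eq_tsum'' _ hint]
  calc ∑' n : Fin k → ℤ, ∫ φ in S, H (n +ᵥ φ) * LatticeSineGordon.weight α g ε ζ (n +ᵥ φ)
      = ∑' n : Fin k → ℤ, ∫ φ in S, H φ * LatticeSineGordon.weight α g ε ζ φ * ef n φ := by
        refine tsum_congr fun n => ?_
        simp_rw [hterm]
    _ = ∫ φ in S, ∑' n : Fin k → ℤ, H φ * LatticeSineGordon.weight α g ε ζ φ * ef n φ :=
        (integral_tsum hF_meas hF_sum).symm
    _ = ∫ φ in S, H φ * LatticeSineGordon.weight α g ε ζ φ * ∑' n : Fin k → ℤ, ef n φ := by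
        refine integral_congr_ae (Filter.Eventually.of_forall fun φ => ?_)
        exact tsum_mul_left
    _ = _ := by
        rw [← integral_indicator hSmeas]


/-- Pointwise identity behind the flat form of the folding: the sector factor of `weight_add_dual`
splits as `e^{+(2g²)⁻¹ ε V⁻¹ Σ_a (Σ_x φ)²} · e^{−(εV/g²/2) |θ̄(φ) + w|²}` (`θ̄ = V⁻¹ Σ_x φ`). -/
private lemma foldFactor_eq {d N k : ℕ} [NeZero N] (b : Fin k → Fin k → ℝ) (g ε : ℝ)
    (φ : LatticeSineGordon.Config d N k) (n : Fin k → ℤ) :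
    Real.exp (-((2 * g ^ 2)⁻¹ * (ε * ∑ p : TorusSite d N × Fin k,
        (2 * φ p * (∑ j : Fin k, (n j : ℝ) * b j p.2) + (∑ j : Fin k, (n j : ℝ) * b j p.2) ^ 2)))) =
      Real.exp ((2 * g ^ 2)⁻¹ * (ε * ((Fintype.card (TorusSite d N) : ℝ)⁻¹ *
        ∑ a : Fin k, (∑ x : TorusSite d N, φ (x, a)) ^ 2))) *
      Real.exp (-(ε * Fintype.card (TorusSite d N) / g ^ 2 / 2) *
        ∑ c : Fin k, ((Fintype.card (TorusSite d N) : ℝ)⁻¹ * ∑ x : TorusSite d N, φ (x, c) +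
          ∑ j : Fin k, (n j : ℝ) * b j c) ^ 2) := by
  set V : ℝ := (Fintype.card (TorusSite d N) : ℝ) with hV
  have hVpos : 0 < V := by
    rw [hV]; exact_mod_cast Fintype.card_pos
  have hVne : V ≠ 0 := hVpos.ne'
  set w : Fin k → ℝ := fun c => ∑ j, (n j : ℝ) * b j c with hw
  rw [← Real.exp_add]
  congr 1
  have hsum_p : ∑ p : TorusSite d N × Fin k, (2 * φ p * w p.2 + w p.2 ^ 2) =
      ∑ a : Fin k, (2 * w a * (∑ x : TorusSite d N, φ (x, a)) + V * w a ^ 2) := by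
    rw [Fintype.sum_prod_type, sum_comm]
    refine sum_congr rfl fun a _ => ?_
    have h1 : ∑ x : TorusSite d N, 2 * φ (x, a) * w (x, a).2 = 2 * w a * ∑ x : TorusSite d N, φ (x, a) := by
      rw [mul_sum]
      exact sum_congr rfl fun x _ => by ring
    have h2 : ∑ x : TorusSite d N, w (x, a).2 ^ 2 = V * w a ^ 2 := by
      show ∑ x : TorusSite d N, w a ^ 2 = V * w a ^ 2
      rw [sum_const, card_univ, nsmul_eq_mul, ← hV]
    rw [sum_add_distrib, h1, h2]
  show -((2 * g ^ 2)⁻¹ * (ε * ∑ p : TorusSite d N × Fin k, (2 * φ p * w p.2 + w p.2 ^ 2))) =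
    (2 * g ^ 2)⁻¹ * (ε * (V⁻¹ * ∑ a : Fin k, (∑ x : TorusSite d N, φ (x, a)) ^ 2)) +
      -(ε * V / g ^ 2 / 2) * ∑ c : Fin k, (V⁻¹ * ∑ x : TorusSite d N, φ (x, c) + w c) ^ 2
  rw [hsum_p]
  have hL : -((2 * g ^ 2)⁻¹ * (ε * ∑ a : Fin k, (2 * w a * (∑ x : TorusSite d N, φ (x, a)) + V * w a ^ 2))) =
      ∑ a : Fin k, -((2 * g ^ 2)⁻¹ * (ε * (2 * w a * (∑ x : TorusSite d N, φ (x, a)) + V * w a ^ 2))) := by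
    rw [mul_sum, mul_sum, ← sum_neg_distrib]
  have hR : (2 * g ^ 2)⁻¹ * (ε * (V⁻¹ * ∑ a : Fin k, (∑ x : TorusSite d N, φ (x, a)) ^ 2)) +
      -(ε * V / g ^ 2 / 2) * ∑ c : Fin k, (V⁻¹ * ∑ x : TorusSite d N, φ (x, c) + w c) ^ 2 =
      ∑ a : Fin k, ((2 * g ^ 2)⁻¹ * (ε * (V⁻¹ * (∑ x : TorusSite d N, φ (x, a)) ^ 2)) +
        -(ε * V / g ^ 2 / 2) * (V⁻¹ * ∑ x : TorusSite d N, φ (x, a) + w a) ^ 2) := by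
    rw [mul_sum, mul_sum, mul_sum, mul_sum, ← sum_add_distrib]
  rw [hL, hR]
  refine sum_congr rfl fun a _ => ?_
  field_simp
  ring

/-- **Folding identity, flat form.** Under the hypotheses of `integral_mul_weight_fold`,
`∫ H · weight = ∫_{θ̄ ∈ D_b} H · W · Θ_a(θ̄)` with the flat reference weight
`W = weight · e^{+(2g²)⁻¹ ε V⁻¹ Σ_a (Σ_x φ(x,a))²} = exp(−(2g²)⁻¹[‖∇φ‖² + ε‖φ − θ̄‖²] + tilt)` (invariant
under all constant shifts: compact flat zero mode, mass `ε` on the non-constant modes only) and the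
zero-mode prior `Θ_a(θ̄) = Σ_{n ∈ ℤᵏ} e^{−(a/2)|θ̄ + Σ_j n_j b_j|²}`, `a = εV/g²` (`latticeTheta_flat`
shows it is flat on `D_b` as `a → 0`). [folklore] -/
theorem integral_mul_weight_fold_flat :
    ∀ (d N k : ℕ) [NeZero N] (ι : Type) [Fintype ι] (α : ι → Fin k → ℝ) (b : Fin k → Fin k → ℝ), LinearIndependent ℝ b → (∀ (j : Fin k) (r : ι), ∃ z : ℤ, ∑ a : Fin k, α r a * b j a = 2 * Real.pi * z) → ∀ (g ε ζ : ℝ), g ≠ 0 → 0 < ε → ∀ (H : LatticeSineGordon.Config d N k → ℝ), Measurable H → ∀ (C₀ : ℝ), (∀ φ, |H φ| ≤ C₀) → (∀ (φ : LatticeSineGordon.Config d N k) (n : Fin k → ℤ), H (fun p => φ p + ∑ j : Fin k, (n j : ℝ) * b j p.2) = H φ) → ∫ φ : LatticeSineGordon.Config d N k, H φ * LatticeSineGordon.weight α g ε ζ φ = ∫ φ : LatticeSineGordon.Config d N k, {φ : LatticeSineGordon.Config d N k | ∃ t : Fin k → ℝ, (∀ j : Fin k, 0 ≤ t j ∧ t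 j < 1) ∧ ∀ a : Fin k, (Fintype.card (TorusSite d N) : ℝ)⁻¹ * ∑ x : TorusSite d N, φ (x, a) = ∑ j : Fin k, t j * b j a}.indicator (fun φ => H φ * (LatticeSineGordon.weight α g ε ζ φ * Real.exp ((2 * g ^ 2)⁻¹ * (ε * ((Fintype.card (TorusSite d N) : ℝ)⁻¹ * ∑ a : Fin k, (∑ x : TorusSite d N, φ (x, a)) ^ 2)))) * ∑' n : Fin k → ℤ, Real.exp (-(ε * Fintype.card (TorusSite d N) / g ^ 2 / 2) * ∑ c : Fin k, ((Fintype.card (TorusSite d N) : ℝ)⁻¹ * ∑ x : TorusSite d N, φ (x, c) + ∑ j : Fin k, (n j : ℝ) * b j c) ^ 2)) φ := by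
  intro d N k _ ι _ α b hb hcomm g ε ζ hg hε H hHm C₀ hHC hHper
  rw [integral_mul_weight_fold d N k ι α b hb hcomm g ε ζ hg hε H hHm C₀ hHC hHper]
  refine integral_congr_ae (Filter.Eventually.of_forall fun φ => ?_)
  by_cases hφ : φ ∈ {φ : LatticeSineGordon.Config d N k | ∃ t : Fin k → ℝ, (∀ j : Fin k, 0 ≤ t j ∧ t j < 1) ∧
      ∀ a : Fin k, (Fintype.card (TorusSite d N) : ℝ)⁻¹ * ∑ x : TorusSite d N, φ (x, a) = ∑ j : Fin k, t j * b j a}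
  · rw [Set.indicator_of_mem hφ, Set.indicator_of_mem hφ]
    simp_rw [foldFactor_eq b g ε φ]
    rw [tsum_mul_left]
    ring
  · rw [Set.indicator_of_notMem hφ, Set.indicator_of_notMem hφ]

end Summit.QuantumFields.YangMills.Theorems.AnchorGap

end
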